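import Summits.QuantumFields.YangMills.Theorems.SourcedPressureJensenSourcedPressureDecouplingDefs
import Mathlib.Data.Nat.Periodic
import HarnessLib

/-!
# Route `SourcedPressureJensen`, crux `SourcedPressureDecoupling` (KS2″, stmt-QuantumFields-24296), line «ENTROPIC-SEAM»:
# the registered stub `stub_count` — tiling combinatorics, PROVED

`stub_count` of the planner's birth skeleton (`bc/line2/SourcedPressureDecoupling_birth_w.lean`; objects `intCard`, `cellCount` in
`…SourcedPressureDecouplingDefs`): for `1 ≤ n`, `8n ≤ ℓ+1`, `16(ℓ+1) ≤ L+1`: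
`(L+1)⁴ ≤ 2·intCard`, `intCard ≤ cellCount`, `cellCount ≤ (1 + 8n/(ℓ+1))·intCard`.
Via the EXACT count `intCard n ℓ L = q⁴·(ℓ+1−n)·ℓ²·(ℓ+1)`, `q = (L+1)/(ℓ+1)` (`intCard_eq`: the interior-pair set is a product of four
coordinate sets, each an initial segment of `q` periods of a residue condition — `card_filter_coord`, `count_mul_of_periodic`), and
elementary real inequalities (`tiling_poly_ineq`).  `G`-free.

Everything is proved; no definition, no named fact.  RECORD-label rung support (route target `XiPow` = an upper bound on the lattice gap);
the Yang–Mills mass gap is NOT proved by anything here. [folklore]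
-/

set_option autoImplicit false

namespace Summit.QuantumFields.YangMills.Cruxes.SourcedPressureDecoupling.EntropicSeam

open Finset

/-! ### Counting: periodic predicates on initial segments -/

/-- A periodic predicate of period `a` has `q · (a.count p)` witnesses below `q·a`. [folklore] -/
theorem count_mul_of_periodic (p : ℕ → Prop) [DecidablePred p] {a : ℕ} (pp : Function.Periodic p a) (q : ℕ) :
    Nat.count p (q * a) = q * Nat.count p a := by
  induction q with
  | zero => simp
  | succ q ih =>
    have hc : Nat.count (fun k => p (q * a + k)) a = Nat.count p a := by
      rw [Nat.count_eq_card_filter_range, Nat.count_eq_card_filter_range]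
      congr 1
      refine Finset.filter_congr fun k _ => ?_
      have h := (pp.nat_mul q) k
      simp only [Nat.cast_id] at h
      rw [add_comm]
      exact Iff.of_eq h
    rw [Nat.succ_mul, Nat.count_add, ih, hc]
    ring

/-- The coordinate sets of the tiling count: for `M = q·(ℓ+1) ≤ L+1` and a predicate `Q` on residues,
`#{y : Fin (L+1) | y < M ∧ Q (y mod (ℓ+1))} = q · #{b < ℓ+1 | Q b}`. [folklore] -/
theorem card_filter_coord (L ℓ q : ℕ) (hM : q * (ℓ + 1) ≤ L + 1) (Q : ℕ → Prop) [DecidablePred Q] :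
    (univ.filter (fun y : Fin (L + 1) => (y : ℕ) < q * (ℓ + 1) ∧ Q ((y : ℕ) % (ℓ + 1)))).card =
      q * ((range (ℓ + 1)).filter Q).card := by
  -- transport to `ℕ` along `Fin.val`
  have h1 : (univ.filter (fun y : Fin (L + 1) => (y : ℕ) < q * (ℓ + 1) ∧ Q ((y : ℕ) % (ℓ + 1)))).card =
      ((range (q * (ℓ + 1))).filter (fun t => Q (t % (ℓ + 1)))).card := by
    refine Finset.card_bij (fun y _ => (y : ℕ)) ?_ ?_ ?_
    · intro y hy
      simp only [mem_filter, mem_univ, true_and] at hy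
      simp only [mem_filter, mem_range]
      exact hy
    · intro y₁ _ y₂ _ h
      exact Fin.ext h
    · intro t ht
      simp only [mem_filter, mem_range] at ht
      refine ⟨⟨t, lt_of_lt_of_le ht.1 hM⟩, ?_, rfl⟩
      simp only [mem_filter, mem_univ, true_and]
      exact ht
  rw [h1]
  -- periodic count
  have hper : Function.Periodic (fun t => Q (t % (ℓ + 1))) (ℓ + 1) := fun t => by
    simp [Nat.add_mod_right]
  have h2 := count_mul_of_periodic (fun t => Q (t % (ℓ + 1))) hper q
  rw [Nat.count_eq_card_filter_range, Nat.count_eq_card_filter_range] at h2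
  rw [h2]
  congr 1
  exact congrArg Finset.card (Finset.filter_congr fun t ht => by rw [Nat.mod_eq_of_lt (mem_range.1 ht)])

/-- `#{b < ℓ+1 | b ≠ ℓ} = ℓ`. [folklore] -/
theorem card_range_filter_ne (ℓ : ℕ) : ((range (ℓ + 1)).filter (fun b => b ≠ ℓ)).card = ℓ := by
  have : (range (ℓ + 1)).filter (fun b => b ≠ ℓ) = range ℓ := by
    ext b
    simp only [mem_filter, mem_range]
    omega
  rw [this, card_range]

/-- `#{b < ℓ+1 | b + n ≤ ℓ} = ℓ + 1 − n`. [folklore] -/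
theorem card_range_filter_add_le (ℓ n : ℕ) : ((range (ℓ + 1)).filter (fun b => b + n ≤ ℓ)).card = ℓ + 1 - n := by
  have : (range (ℓ + 1)).filter (fun b => b + n ≤ ℓ) = range (ℓ + 1 - n) := by
    ext b
    simp only [mem_filter, mem_range]
    omega
  rw [this, card_range]

/-- `#{b < ℓ+1 | True} = ℓ + 1`. [folklore] -/
theorem card_range_filter_true (ℓ : ℕ) : ((range (ℓ + 1)).filter (fun _ => True)).card = ℓ + 1 := by
  rw [filter_true_of_mem (fun _ _ => trivial), card_range]

/-! ### The interior-pair count of the tiling -/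

/-- **The tiling count**: `intCard n ℓ L = q⁴ · (ℓ+1−n) · ℓ · ℓ · (ℓ+1)` with `q = (L+1)/(ℓ+1)` (coordinate `0`: residue `≤ ℓ−n`;
coordinates `1, 2`: residue `≠ ℓ`; coordinate `3`: free; all four below `q(ℓ+1)`). [folklore] -/
theorem intCard_eq (n ℓ L : ℕ) :
    intCard n ℓ L = ((L + 1) / (ℓ + 1)) ^ 4 * ((ℓ + 1 - n) * ℓ * ℓ * (ℓ + 1)) := by
  classical
  set q : ℕ := (L + 1) / (ℓ + 1) with hq
  have hM : q * (ℓ + 1) ≤ L + 1 := Nat.div_mul_le_self (L + 1) (ℓ + 1)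
  -- the coordinate sets
  set S₀ : Finset (Fin (L + 1)) :=
    univ.filter (fun y : Fin (L + 1) => (y : ℕ) < q * (ℓ + 1) ∧ (y : ℕ) % (ℓ + 1) + n ≤ ℓ) with hS₀
  set S₁ : Finset (Fin (L + 1)) :=
    univ.filter (fun y : Fin (L + 1) => (y : ℕ) < q * (ℓ + 1) ∧ (y : ℕ) % (ℓ + 1) ≠ ℓ) with hS₁
  set S₃ : Finset (Fin (L + 1)) :=
    univ.filter (fun y : Fin (L + 1) => (y : ℕ) < q * (ℓ + 1) ∧ True) with hS₃
  have hset : univ.filter (fun x : Fin 4 → Fin (L + 1) => ((∀ k : Fin 4, ((x k : ℕ)) < ((L + 1) / (ℓ + 1)) * (ℓ + 1)) ∧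
      ((x 1 : ℕ)) % (ℓ + 1) ≠ ℓ ∧ ((x 2 : ℕ)) % (ℓ + 1) ≠ ℓ ∧ ((x 0 : ℕ)) % (ℓ + 1) + n ≤ ℓ)) =
      Fintype.piFinset ![S₀, S₁, S₁, S₃] := by
    ext x
    simp only [mem_filter, mem_univ, true_and, Fintype.mem_piFinset, ← hq]
    constructor
    · rintro ⟨hM', h1, h2, h0⟩ k
      fin_cases k
      · simp only [hS₀, Fin.zero_eta, Matrix.cons_val_zero, mem_filter, mem_univ, true_and]; exact ⟨hM' 0, h0⟩
      · simp only [hS₁, Fin.mk_one, Matrix.cons_val_one, Matrix.cons_val_zero, mem_filter, mem_univ, true_and]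
        exact ⟨hM' 1, h1⟩
      · simp only [hS₁, Fin.reduceFinMk, Matrix.cons_val, mem_filter, mem_univ, true_and]
        exact ⟨hM' 2, h2⟩
      · simp only [hS₃, Fin.reduceFinMk, Matrix.cons_val, mem_filter, mem_univ, true_and, and_true]
        exact hM' 3
    · intro h
      have h0 := h 0
      have h1 := h 1
      have h2 := h 2
      have h3 := h 3
      simp only [hS₀, hS₁, hS₃, Fin.isValue, Matrix.cons_val_zero, Matrix.cons_val_one, Matrix.cons_val,
        mem_filter, mem_univ, true_and, and_true] at h0 h1 h2 h3
      refine ⟨fun k => ?_, h1.2, h2.2, h0.2⟩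
      fin_cases k
      · exact h0.1
      · exact h1.1
      · exact h2.1
      · exact h3
  rw [intCard, hset, Fintype.card_piFinset, Fin.prod_univ_four]
  simp only [Fin.isValue, Matrix.cons_val_zero, Matrix.cons_val_one, Matrix.cons_val]
  have e0 : S₀.card = q * (ℓ + 1 - n) := by
    rw [hS₀, card_filter_coord L ℓ q hM (fun b => b + n ≤ ℓ), card_range_filter_add_le]
  have e1 : S₁.card = q * ℓ := by
    rw [hS₁, card_filter_coord L ℓ q hM (fun b => b ≠ ℓ), card_range_filter_ne]
  have e3 : S₃.card = q * (ℓ + 1) := by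
    rw [hS₃, card_filter_coord L ℓ q hM (fun _ => True), card_range_filter_true]
  rw [e0, e1, e3]
  ring

/-! ### The three tiling inequalities (`stub_count`) -/

/-- The polynomial inequality behind the third bound: for reals `a ≥ 8n`, `n ≥ 1`:
`a⁴·a ≤ (a + 8n)·((a − n)·(a−1)·(a−1)·a)`. [folklore] -/
theorem tiling_poly_ineq {a n : ℝ} (hn : 1 ≤ n) (ha : 8 * n ≤ a) :
    a ^ 4 * a ≤ (a + 8 * n) * ((a - n) * (a - 1) * (a - 1) * a) := by
  have ha8 : 8 ≤ a := by linarith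
  have hn0 : 0 ≤ n := by linarith
  have ha0 : 0 ≤ a := by linarith
  have step1 : a * (a + 6 * n) ≤ (a + 8 * n) * (a - n) := by
    nlinarith [mul_nonneg hn0 (sub_nonneg.2 ha)]
  have hsq : 8 * a ≤ a * a := by nlinarith
  have step2 : a ^ 3 ≤ (a + 6 * n) * ((a - 1) * (a - 1)) := by
    nlinarith [mul_nonneg (by linarith : (0 : ℝ) ≤ 6 * n - 2) (by linarith : (0 : ℝ) ≤ a * a - 8 * a),
      mul_nonneg hn0 ha0]
  have hsq0 : 0 ≤ (a - 1) * (a - 1) := mul_self_nonneg _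
  calc a ^ 4 * a = a * (a * a ^ 3) := by ring
    _ ≤ a * (a * ((a + 6 * n) * ((a - 1) * (a - 1)))) := by gcongr
    _ = (a * (a + 6 * n)) * ((a - 1) * (a - 1)) * a := by ring
    _ ≤ ((a + 8 * n) * (a - n)) * ((a - 1) * (a - 1)) * a := by gcongr
    _ = (a + 8 * n) * ((a - n) * (a - 1) * (a - 1) * a) := by ring

/-- **`stub_count`** (registered stub of the KS2″ line «ENTROPIC-SEAM», G-free tiling combinatorics): for `1 ≤ n`, `8n ≤ ℓ+1`,
`16(ℓ+1) ≤ L+1`: `(L+1)⁴ ≤ 2·intCard`, `intCard ≤ cellCount`, `cellCount ≤ (1 + 8n/(ℓ+1))·intCard`. [folklore] -/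
theorem stub_count_explicit :
    ∀ n ℓ L : ℕ, 1 ≤ n → 8 * n ≤ ℓ + 1 → 16 * (ℓ + 1) ≤ L + 1 →
      (L + 1 : ℝ) ^ 4 ≤ 2 * (intCard n ℓ L : ℝ) ∧ (intCard n ℓ L : ℝ) ≤ (cellCount ℓ L : ℝ) ∧
        (cellCount ℓ L : ℝ) ≤ (1 + 8 * (n : ℝ) / (ℓ + 1 : ℝ)) * (intCard n ℓ L : ℝ) := by
  intro n ℓ L hn h8 h16
  -- the integer data as reals
  set q : ℕ := (L + 1) / (ℓ + 1) with hq
  have hnl : n ≤ ℓ + 1 := by omega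
  have hI : (intCard n ℓ L : ℝ) = (q : ℝ) ^ 4 * (((ℓ : ℝ) + 1 - n) * ℓ * ℓ * (ℓ + 1)) := by
    rw [intCard_eq, ← hq]; push_cast [Nat.cast_sub hnl]; ring
  have hC : (cellCount ℓ L : ℝ) = (q : ℝ) ^ 4 * ((ℓ : ℝ) + 1) ^ 4 := by
    rw [cellCount, ← hq]; push_cast; ring
  have hapos : (0 : ℝ) < (ℓ : ℝ) + 1 := by positivity
  have hqa' : (L : ℝ) + 1 < ((q : ℝ) + 1) * ((ℓ : ℝ) + 1) := by
    have h := Nat.lt_div_mul_add (a := L + 1) (b := ℓ + 1) (Nat.succ_pos ℓ)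
    rw [← hq] at h
    have h' : ((L + 1 : ℕ) : ℝ) < ((q * (ℓ + 1) + (ℓ + 1) : ℕ) : ℝ) := by exact_mod_cast h
    push_cast at h'
    linarith
  have hq16 : (16 : ℝ) ≤ q := by
    have : 16 ≤ q := by
      rw [hq, Nat.le_div_iff_mul_le (Nat.succ_pos ℓ)]
      exact h16
    exact_mod_cast this
  have ha8 : 8 * (n : ℝ) ≤ (ℓ : ℝ) + 1 := by exact_mod_cast h8
  have hn1 : (1 : ℝ) ≤ n := by exact_mod_cast hn
  have hq0 : (0 : ℝ) ≤ q := Nat.cast_nonneg _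
  have hl0 : (0 : ℝ) ≤ ℓ := Nat.cast_nonneg _
  -- scalar consequences
  have hL : (L : ℝ) + 1 ≤ (17 / 16) * ((q : ℝ) * ((ℓ : ℝ) + 1)) := by nlinarith
  have hl78 : (7 / 8) * ((ℓ : ℝ) + 1) ≤ ℓ := by nlinarith
  have hln : (7 / 8) * ((ℓ : ℝ) + 1) ≤ (ℓ : ℝ) + 1 - n := by nlinarith
  have hln0 : 0 ≤ (ℓ : ℝ) + 1 - n := by linarith
  refine ⟨?_, ?_, ?_⟩
  · -- (L+1)^4 ≤ 2 intCard
    rw [hI]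
    have h4 : ((L : ℝ) + 1) ^ 4 ≤ ((17 / 16) * ((q : ℝ) * ((ℓ : ℝ) + 1))) ^ 4 :=
      pow_le_pow_left₀ (by positivity) hL 4
    have h78 : 0 ≤ (7 / 8) * ((ℓ : ℝ) + 1) := by positivity
    have hB : ((7 / 8) * ((ℓ : ℝ) + 1)) * ((7 / 8) * ((ℓ : ℝ) + 1)) * ((7 / 8) * ((ℓ : ℝ) + 1)) * ((ℓ : ℝ) + 1) ≤
        ((ℓ : ℝ) + 1 - n) * ℓ * ℓ * (ℓ + 1) := by
      gcongr
    have hnum : ((17 / 16 : ℝ)) ^ 4 ≤ 2 * (7 / 8 : ℝ) ^ 3 := by norm_num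
    calc ((L : ℝ) + 1) ^ 4 ≤ ((17 / 16) * ((q : ℝ) * ((ℓ : ℝ) + 1))) ^ 4 := h4
      _ = (17 / 16 : ℝ) ^ 4 * ((q : ℝ) ^ 4 * ((ℓ : ℝ) + 1) ^ 4) := by ring
      _ ≤ (2 * (7 / 8 : ℝ) ^ 3) * ((q : ℝ) ^ 4 * ((ℓ : ℝ) + 1) ^ 4) :=
          mul_le_mul_of_nonneg_right hnum (by positivity)
      _ = 2 * ((q : ℝ) ^ 4 * (((7 / 8) * ((ℓ : ℝ) + 1)) * ((7 / 8) * ((ℓ : ℝ) + 1)) * ((7 / 8) * ((ℓ : ℝ) + 1)) *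
            ((ℓ : ℝ) + 1))) := by ring
      _ ≤ 2 * ((q : ℝ) ^ 4 * (((ℓ : ℝ) + 1 - n) * ℓ * ℓ * (ℓ + 1))) := by
          gcongr
  · -- intCard ≤ cellCount
    rw [hI, hC]
    refine mul_le_mul_of_nonneg_left ?_ (by positivity)
    have h1 : ((ℓ : ℝ) + 1 - n) ≤ (ℓ : ℝ) + 1 := by linarith
    have h2 : (ℓ : ℝ) ≤ (ℓ : ℝ) + 1 := by linarith
    calc ((ℓ : ℝ) + 1 - n) * ℓ * ℓ * (ℓ + 1) ≤ ((ℓ : ℝ) + 1) * (ℓ + 1) * (ℓ + 1) * (ℓ + 1) := by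
          gcongr
      _ = ((ℓ : ℝ) + 1) ^ 4 := by ring
  · -- cellCount ≤ (1 + 8n/(ℓ+1)) intCard
    rw [hI, hC]
    have hpoly := tiling_poly_ineq hn1 ha8
    have key : ((ℓ : ℝ) + 1) ^ 4 ≤ (1 + 8 * (n : ℝ) / ((ℓ : ℝ) + 1)) * (((ℓ : ℝ) + 1 - n) * ℓ * ℓ * (ℓ + 1)) := by
      have hrw : (1 + 8 * (n : ℝ) / ((ℓ : ℝ) + 1)) = (((ℓ : ℝ) + 1) + 8 * n) / ((ℓ : ℝ) + 1) := by
        field_simp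
      rw [hrw, div_mul_eq_mul_div, le_div_iff₀ hapos]
      have hl : (ℓ : ℝ) = ((ℓ : ℝ) + 1) - 1 := by ring
      calc ((ℓ : ℝ) + 1) ^ 4 * ((ℓ : ℝ) + 1)
          ≤ (((ℓ : ℝ) + 1) + 8 * n) * ((((ℓ : ℝ) + 1) - n) * (((ℓ : ℝ) + 1) - 1) * (((ℓ : ℝ) + 1) - 1) * ((ℓ : ℝ) + 1)) :=
            hpoly
        _ = (((ℓ : ℝ) + 1) + 8 * n) * (((ℓ : ℝ) + 1 - n) * ℓ * ℓ * (ℓ + 1)) := by ring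
    calc (q : ℝ) ^ 4 * ((ℓ : ℝ) + 1) ^ 4
        ≤ (q : ℝ) ^ 4 * ((1 + 8 * (n : ℝ) / ((ℓ : ℝ) + 1)) * (((ℓ : ℝ) + 1 - n) * ℓ * ℓ * (ℓ + 1))) :=
          mul_le_mul_of_nonneg_left key (by positivity)
      _ = (1 + 8 * (n : ℝ) / ((ℓ : ℝ) + 1)) * ((q : ℝ) ^ 4 * (((ℓ : ℝ) + 1 - n) * ℓ * ℓ * (ℓ + 1))) := by ring

set_option linter.style.nameCheck false in
/-- STUB (tiling combinatorics; S/M, G-free).  `intCard = q⁴(ℓ+1)·ℓ²·(ℓ+1−n)`, `cellCount = q⁴(ℓ+1)⁴`, `(L+1)⁴ < (q+1)⁴(ℓ+1)⁴`.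
Registered statement of `stub_count` (name-keyed alias, device of `Cruxes/*/Lines/birth.lean`: the skeleton audit admits a
hypothesis of the composition only if its head constant is named like a declared stub). -/
abbrev __Registered.stub_count : Prop :=
  ∀ n ℓ L : ℕ, 1 ≤ n → 8 * n ≤ ℓ + 1 → 16 * (ℓ + 1) ≤ L + 1 →
    (L + 1 : ℝ) ^ 4 ≤ 2 * (intCard n ℓ L : ℝ) ∧ (intCard n ℓ L : ℝ) ≤ (cellCount ℓ L : ℝ) ∧
      (cellCount ℓ L : ℝ) ≤ (1 + 8 * (n : ℝ) / (ℓ + 1 : ℝ)) * (intCard n ℓ L : ℝ)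

/-- **`stub_count`** in the REGISTERED form of the KS2″ skeleton (statement `__Registered.stub_count`). [folklore] -/
theorem stub_count : __Registered.stub_count := stub_count_explicit

end Summit.QuantumFields.YangMills.Cruxes.SourcedPressureDecoupling.EntropicSeam
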